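import Summits.KontsevichZagierPeriods.KontsevichZagierPeriods.Theses.HyperbolicBloch
import Summits.KontsevichZagierPeriods.KontsevichZagierPeriods.Theorems.HyperbolicBlochPachnerTwoThreePointwise
import Literature.MeasureTheory.Lebesgue.PolynomialZeroSet

/-!
# `PachnerTwoThree`, line `exchange-identity-symmdiff`: the scaffold of the 2–3 move is null

Stub `stub_nullScaffold` of the crux `HyperbolicBloch.PachnerTwoThree`
(stmt-KontsevichZagierPeriods-3470, route HyperbolicBloch, line `exchange-identity-symmdiff`).
For the crux's verbatim edge form `L u v p` (planar cross product, "left of `u → v`") and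
circumsphere form `S u v w p` (the insphere determinant of the hemisphere through `u, v, w`), and for
`q̂ = (Re q, Im q, 0)` strictly inside the counter-clockwise ideal triangle `(u, v, w)`, we prove that
the scaffold of the 2–3 Pachner move
`{S u v w = 0} ∪ {L u q = 0} ∪ {L v q = 0} ∪ {L w q = 0}` — the big hemisphere and the three spoke
planes through the inner vertex — is Lebesgue-null in `ℝ³`.

Each of the four pieces is the zero set of a NON-ZERO real polynomial in three variables, hence null
by the tree's `MvPolynomial.volume_zeroSet_eq_zero` (Caron–Traynor); the pieces are assembled with
`measure_union_null`.  Non-vanishing witnesses (companion file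
`Theorems/HyperbolicBlochPachnerTwoThreePointwise`, the pointwise 2–3 identity off this scaffold):
the spoke plane `L u q` at the far vertex `ŵ = (Re w, Im w, 0)` equals the barycentric weight
`L w u q̂ > 0` (`L_uq_hat_w`, and cyclically), and the power of the inner point is negative,
`S u v w q̂ < 0` (`S_hat_neg`, from the barycentric power identity
`A · S u v w q̂ = −(|v−w|² βγ + |w−u|² γα + |u−v|² αβ)`).

Adapted from the standing disprover's kernel-checked `Cruxes/PachnerTwoThree/Disproof.lean` §3
(`volume_scaffold_eq_zero`, refuter-cdisprove, 2026-08-15), which a refuter may not land under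
`Theorems/`.

References: M. Kontsevich, D. Zagier, *Periods* (2001) §1.2 rule (1a) (additivity modulo null sets);
J. Dupont, C.-H. Sah, *Scissors congruences II*, J. Pure Appl. Algebra 25 (1982) (5.3) (the 2–3 move
= five-term relation); R. Caron, T. Traynor, *The zero set of a polynomial* (2005).
-/

noncomputable section

open Set MeasureTheory MvPolynomial

namespace Summit.KontsevichZagierPeriods.HyperbolicBloch.PachnerTwoThree

section Scaffold

variable {L : ℂ → ℂ → (Fin 3 → ℝ) → ℝ} {S : ℂ → ℂ → ℂ → (Fin 3 → ℝ) → ℝ}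

variable (hL : ∀ u v p, L u v p = (v.re - u.re) * (p 1 - u.im) - (v.im - u.im) * (p 0 - u.re))
  (hS : ∀ u v w p, S u v w p = (p 0 ^ 2 + p 1 ^ 2 + p 2 ^ 2) * (u.re * (v.im - w.im) - u.im * (v.re - w.re) + (v.re * w.im - v.im * w.re)) - p 0 * (Complex.normSq u * (v.im - w.im) - u.im * (Complex.normSq v - Complex.normSq w) + (Complex.normSq v * w.im - v.im * Complex.normSq w)) + p 1 * (Complex.normSq u * (v.re - w.re) - u.re * (Complex.normSq v - Complex.normSq w) + (Complex.normSq v * w.re - v.re * Complex.normSq w)) - (Complex.normSq u * (v.re * w.im - v.im * w.re) - u.re * (Complex.normSq v * w.im - v.im * Complex.normSq w) + u.im * (Complex.normSq v * w.re - v.re * Complex.normSq w)))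

include hL in
/-- A vertical spoke plane `{L u q = 0}` which misses one point is Lebesgue-null: `L u q` is the
evaluation of the linear polynomial `−(Im q − Im u) X₀ + (Re q − Re u) X₁ + c`, non-zero since it does
not vanish at `p₀`. -/
theorem scaffold_volume_setOf_L_eq_zero {u q : ℂ} {p₀ : Fin 3 → ℝ} (h : L u q p₀ ≠ 0) :
    volume {p : Fin 3 → ℝ | L u q p = 0} = 0 := by
  set P : MvPolynomial (Fin 3) ℝ := C (-(q.im - u.im)) * X 0 + C (q.re - u.re) * X 1
    + C ((q.im - u.im) * u.re - (q.re - u.re) * u.im) with hP_def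
  have hev : ∀ p, eval p P = L u q p := fun p => by
    rw [hL, hP_def]
    simp only [map_add, map_mul, eval_C, eval_X]
    ring
  have hP : P ≠ 0 := fun h0 => h (by rw [← hev, h0, map_zero])
  have hset : {p : Fin 3 → ℝ | L u q p = 0} = {p | eval p P = 0} := by
    ext p; rw [mem_setOf_eq, mem_setOf_eq, hev]
  rw [hset]
  exact MvPolynomial.volume_zeroSet_eq_zero 3 P hP

include hS in
/-- A sphere `{S u v w = 0}` which misses one point is Lebesgue-null: `S u v w` is the evaluation of
the quadratic polynomial `(X₀² + X₁² + X₂²) c₁ − X₀ c₂ + X₁ c₃ − c₄`, non-zero since it does not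
vanish at `p₀`. -/
theorem scaffold_volume_setOf_S_eq_zero {u v w : ℂ} {p₀ : Fin 3 → ℝ} (h : S u v w p₀ ≠ 0) :
    volume {p : Fin 3 → ℝ | S u v w p = 0} = 0 := by
  set P : MvPolynomial (Fin 3) ℝ :=
    (X 0 ^ 2 + X 1 ^ 2 + X 2 ^ 2) * C (u.re * (v.im - w.im) - u.im * (v.re - w.re) + (v.re * w.im - v.im * w.re))
    - X 0 * C (Complex.normSq u * (v.im - w.im) - u.im * (Complex.normSq v - Complex.normSq w) + (Complex.normSq v * w.im - v.im * Complex.normSq w))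
    + X 1 * C (Complex.normSq u * (v.re - w.re) - u.re * (Complex.normSq v - Complex.normSq w) + (Complex.normSq v * w.re - v.re * Complex.normSq w))
    - C (Complex.normSq u * (v.re * w.im - v.im * w.re) - u.re * (Complex.normSq v * w.im - v.im * Complex.normSq w) + u.im * (Complex.normSq v * w.re - v.re * Complex.normSq w))
    with hP_def
  have hev : ∀ p, eval p P = S u v w p := fun p => by
    rw [hS, hP_def]
    simp only [map_add, map_sub, map_mul, map_pow, eval_C, eval_X]
  have hP : P ≠ 0 := fun h0 => h (by rw [← hev, h0, map_zero])
  have hset : {p : Fin 3 → ℝ | S u v w p = 0} = {p | eval p P = 0} := by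
    ext p; rw [mem_setOf_eq, mem_setOf_eq, hev]
  rw [hset]
  exact MvPolynomial.volume_zeroSet_eq_zero 3 P hP

include hL hS in
/-- **The scaffold of the 2–3 move is null**: for `q̂` strictly inside the ccw triangle `(u, v, w)`,
the big sphere `S u v w = 0` and the three spoke planes `L u q = 0`, `L v q = 0`, `L w q = 0` form a
Lebesgue-null set (witnesses: `S u v w q̂ < 0`, `L u q ŵ = β > 0`, `L v q û = γ > 0`,
`L w q v̂ = α > 0`). -/
theorem scaffold_volume_eq_zero {u v w q : ℂ} (h1 : 0 < L u v ![q.re, q.im, 0])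
    (h2 : 0 < L v w ![q.re, q.im, 0]) (h3 : 0 < L w u ![q.re, q.im, 0]) :
    volume {p : Fin 3 → ℝ | S u v w p = 0 ∨ L u q p = 0 ∨ L v q p = 0 ∨ L w q p = 0} = 0 := by
  have hSq : S u v w ![q.re, q.im, 0] ≠ 0 := (S_hat_neg hL hS h1 h2 h3).ne
  have hu : L u q ![w.re, w.im, 0] ≠ 0 := by rw [L_uq_hat_w hL]; exact h3.ne'
  have hv : L v q ![u.re, u.im, 0] ≠ 0 := by rw [L_vq_hat_u hL]; exact h1.ne'
  have hw : L w q ![v.re, v.im, 0] ≠ 0 := by rw [L_wq_hat_v hL]; exact h2.ne'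
  simp only [setOf_or]
  exact measure_union_null (scaffold_volume_setOf_S_eq_zero hS hSq)
    (measure_union_null (scaffold_volume_setOf_L_eq_zero hL hu)
      (measure_union_null (scaffold_volume_setOf_L_eq_zero hL hv)
        (scaffold_volume_setOf_L_eq_zero hL hw)))

end Scaffold

/-- **Stub `stub_nullScaffold`** of line `exchange-identity-symmdiff` (registered signature): for
`q̂` strictly inside the ccw triangle `(u, v, w)` the scaffold of the 2–3 move — the big sphere
`S u v w = 0` and the three spoke planes `L u q = 0`, `L v q = 0`, `L w q = 0` — is Lebesgue-null,
for the crux's verbatim `L`, `S`. -/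
theorem stub_nullScaffold : ∀ (L : ℂ → ℂ → (Fin 3 → ℝ) → ℝ), (∀ u v p, L u v p = (v.re - u.re) * (p 1 - u.im) - (v.im - u.im) * (p 0 - u.re)) → ∀ (S : ℂ → ℂ → ℂ → (Fin 3 → ℝ) → ℝ), (∀ u v w p, S u v w p = (p 0 ^ 2 + p 1 ^ 2 + p 2 ^ 2) * (u.re * (v.im - w.im) - u.im * (v.re - w.re) + (v.re * w.im - v.im * w.re)) - p 0 * (Complex.normSq u * (v.im - w.im) - u.im * (Complex.normSq v - Complex.normSq w) + (Complex.normSq v * w.im - v.im * Complex.normSq w)) + p 1 * (Complex.normSq u * (v.re - w.re) - u.re * (Complex.normSq v - Complex.normSq w) + (Complex.normSq v * w.re - v.re * Complex.normSq w)) - (Complex.normSq u * (v.re * w.im - v.im * w.re) - u.re * (Complex.normSq v * w.im - v.im * Complex.normSq w) + u.im * (Complex.normSq v * w.re - v.re * Complex.normSq w))) → ∀ (u v w q : ℂ), 0 < L u v ![q.re, q.im, 0] → 0 < L v w ![q.re, q.im, 0] → 0 < L w u ![q.re, q.im, 0] → MeasureTheory.volume {p : Fin 3 → ℝ | S u v w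 p = 0 ∨ L u q p = 0 ∨ L v q p = 0 ∨ L w q p = 0} = 0 := by
  intro L hL S hS u v w q h1 h2 h3
  exact scaffold_volume_eq_zero hL hS h1 h2 h3

end Summit.KontsevichZagierPeriods.HyperbolicBloch.PachnerTwoThree

end
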